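import Summits.BirchSwinnertonDyer.BirchSwinnertonDyer.Theorems.ErratumRoadFiveNonSurjCornerHybridTwinMuAnDeepCore
import HarnessLib

/-!
# Route `ErratumRoadFive` (rung K2), crux `NonSurjCorner` (item stmt-BirchSwinnertonDyer-19065), REGISTERED line `Lines/hybrid.lean` (r17, Hida-keyed):
# THE `Ш_an`-CUT OF THE μ-SLOT ON THE LINE OF RECORD — glue #20H (= glue #19 with item 19948 asked only where an analytic Ш of the pair is not a
# p-adic unit) and the projection 19948 ⟹ cut; the composition of the r18 skeleton candidate
# (cell `bsd-stepL`, seat `bsd-stepL-corner-p1` g18; `--supports stmt-BirchSwinnertonDyer-19065 --as helper`)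

WHY THIS FILE. `…HybridTwinMuAnDeepCore` (p640833) showed that in the hybrid composition Kato's divisibility at the twin — hence μ = 0 as its
integrality input — is consumed only by the CONVERSE half of `E`, i.e. only at the DEEP corner pairs (`#Ш(E)_an = s`, `0 < ord_p s`). In the
REGISTERED line (r17) slot 4 is the six Hida facts (RULING 48: 19064 kept out of the cone), and there the twin's LOWER half — used by the Euler half
of `E` at every pair, but asked only at the twins whose own analytic Ш is not a `p`-adic unit (`¬ X11a.ShaAnUnit Wd p`, g13's «lowerLeafTwinDeep») —
is produced from μ = 0 AT THAT TWIN by x11a's per-pair door `ClassX11a.missingLowerBoundAt_of_muAnZeroAt_of_not_surj_of_contraFacts_of_mazur`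
(EPW λ-transfer + Wan + Kato, Mazur 4.1). So on the line of record the honest cut of slot 2 is the CONJUNCTION of
(2a) μ = 0 at every non-surjective X11a leaf twin `Wd` at `p ∈ {5,7}` with `p ∣ ord_p Δ_min(Wd)` whose OWN `#Ш(Wd)_an` is not a `p`-adic unit, and
(2b) μ = 0 at the Friedberg–Hoffstein twin models of the DEEP corner pairs (the Core's `hdivD` locus) —
i.e. item 19948 is IDLE exactly where both analytic Ш's in play are `p`-adic units. Both clauses keep 19948's allowable-root currency VERBATIM.
* §1 GLUE #20H `nonSurjCorner_of_kolyZShaAn_of_twinMuAnDeepOr_of_fifteenFacts_of_hidaFacts_of_twoPlusFourNamedInputs_of_carrierLabelsB6_pAnchor` —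
  glue #19 (`…HybridLabelsOnly`, p635538) with `hμ : NonSurjCornerTwinMuAn` replaced by `hμ2 : (2a) ∧ (2b)`; proof = glue #19 over the Core, the
  twin-lower door fed pointwise (`muAnZeroAt_of_allowableRootShape` + the x11a door) and the twin-upper fed from (2b);
* §2 `twinMuAnDeepOr_of_twinMuAn` — item 19948 implies `(2a) ∧ (2b)` (projection), so r17's slots still close the line through glue #20H.

HONEST FRAMING: TWO THEOREMS (no definition, no named fact, no `sorry`); CONDITIONAL on every displayed binder; no stub is proved — one open input
(19948) is shown IDLE off the locus «some analytic Ш of the pair has positive p-valuation»; 19065 NOT closed by this file; nothing about any curve's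
BSD; BSD is not advanced; T7.
References (locators only): [cite: Kato2004Asterisque, Thm. 12.4, §17.13 (pp. 279–280)] [cite: GreenbergLNM1716, §1 Conj. 1.11 (p. 61)]
[cite: EmertonPollackWeston2006, Thm. 1, Thm. 3.1.1, Thm. 5.1.3] [cite: Wan2015, Thm. 4] [cite: Mazur1978, Cor. 4.1] [cite: Cha2005, Thm. 21 and Rmk. 25]
[cite: PastenShimura2024, Prop. 6.13, Lemma 6.18] [cite: Miller2011LMS, Def. 1.1].
-/

set_option autoImplicit false
set_option linter.dupNamespace false -- `Summit.BirchSwinnertonDyer.BirchSwinnertonDyer` (summit = problem), tree-wide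

noncomputable section

open scoped Classical NumberField MatrixGroups ModularForm

/-! ### §1 Glue #20H: glue #19 (Hida-keyed, line of record) with the μ-slot cut -/

namespace Summit.BirchSwinnertonDyer.BirchSwinnertonDyer.Theorems

open CongruenceSubgroup WeierstrassCurve NumberField IsDedekindDomain Field Rat.HeightOneSpectrum
  Literature.NumberTheory.EllipticCurves
  Literature.NumberTheory.EllipticCurves.ModularForms
  Literature.NumberTheory.Automorphic
  Literature.NumberTheory.EllipticCurves.Rank1Residual
  Literature.NumberTheory.EllipticCurves.Rank1Residual.Typed
  Literature.NumberTheory.EllipticCurves.Wuthrich2014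
  Literature.NumberTheory.EllipticCurves.SteinWuthrich2013
  Literature.NumberTheory.EllipticCurves.Greenberg1999
  Literature.NumberTheory.EllipticCurves.Kato2004
  Literature.NumberTheory.EllipticCurves.BarriosEtAl2025
  Literature.NumberTheory.EllipticCurves.EmertonPollackWeston2006
  Literature.NumberTheory.EllipticCurves.ShimuraCMFamily
  Literature.NumberTheory.GaloisRepresentations Literature.NumberTheory.GaloisCohomology
  Summit.BirchSwinnertonDyer.Rank1Residual
  Summit.BirchSwinnertonDyer.Rank1Residual.X11b
  Summit.BirchSwinnertonDyer.Rank1Residual.X11b.Three.Koly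
  Summit.BirchSwinnertonDyer.BirchSwinnertonDyer.Theses.ErratumRoadFive

/-- **GLUE #20H — glue #19 (the line of record's composition: slot 4 = six Hida facts) with slot 2 (item 19948) CUT to the locus «some analytic Ш
of the pair has positive `p`-valuation».** Binders: `hZan` (slot 1) → `hμ2 = (2a) ∧ (2b)` (slot 2 cut: μ = 0 at the leaf twins `Wd` with
`¬ X11a.ShaAnUnit Wd p`, feeding the twin's LOWER half through x11a's per-pair door; and μ = 0 at the Friedberg–Hoffstein twins of the DEEP corner
pairs, feeding the twin's UPPER half through the Core) → `hF3` (fifteen facts) → `hHida` (six) → hMax2 → hShim4 → `hLabB6T` → `NonSurjCorner`.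
Proof = glue #19 over `…HybridTwinMuAnDeepCore` §1. CONDITIONAL on every binder; 19065 NOT closed; nothing booked; T7.
[cite: Kato2004Asterisque, Thm. 12.4, §17.13 (pp. 279–280)] [cite: EmertonPollackWeston2006, Thm. 5.1.3] [cite: Wan2015, Thm. 4] [cite: Mazur1978, Cor. 4.1]
[cite: GreenbergLNM1716, §1 Conj. 1.11 (p. 61)] [cite: PastenShimura2024, Lemma 6.18] [cite: Cha2005, Thm. 21 and Rmk. 25] [cite: Miller2011LMS, Def. 1.1] -/
theorem nonSurjCorner_of_kolyZShaAn_of_twinMuAnDeepOr_of_fifteenFacts_of_hidaFacts_of_twoPlusFourNamedInputs_of_carrierLabelsB6_pAnchor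
    (hZan : ∀ (W : WeierstrassCurve ℚ) [W.IsElliptic] [W.IsGloballyMinimal] (p : ℕ) [Fact p.Prime]
      (N : ℕ) [NeZero N] (K : Type) [Field K] [NumberField K]
      (Dt : ModularParametrizationData W N) (β : ℤ) (ι : K →+* ℂ),
      ClassX11b W p → ¬ Surj W p → (p = 5 ∨ p = 7) → p ∣ padicValInt p W.minimalDiscriminantInt →
      ¬ Ram W p → (∃ s : ℚ, shaAn W = (s : ℂ) ∧ 0 < padicValRat p s) →
      W.conductorNorm ℤ = N → IsImaginaryQuadratic K →
      4 < (NumberField.discr K).natAbs → SatisfiesHeegnerHypothesis N K →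
      SatisfiesHeegnerHypothesis p K → (4 * (N : ℤ)) ∣ β ^ 2 - NumberField.discr K → ¬ (p : ℤ) ∣ Dt.c →
      (∃ (d₁ : KolyvaginHeegnerData Dt β ι 1) (y : (W.baseChange K).toAffine.Point),
        WeierstrassCurve.Affine.Point.map (W' := W) (algebraMap K (ringClassField K ι 1)).toRatAlgHom y =
          d₁.derivedPoint ∧
        ∃ Q : (W.baseChange K).toAffine.Point, ((p ^ (padicValNat p W.tamagawaProduct + 1) : ℕ) : ℤ) • Q = y) →
      ∃ M : ℕ, M ≤ padicValNat p W.tamagawaProduct ∧ CertificateAt Dt β ι p M)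
    -- slot 2 CUT (this file): μ = 0 only (2a) at the leaf twins whose own #Ш_an is not a p-unit and (2b) at the FH twins of the DEEP corner pairs
    (hμ2 :
      (∀ (Wd : WeierstrassCurve ℚ) [Wd.IsElliptic] [Wd.IsGloballyMinimal] (p : ℕ) [Fact p.Prime],
        ClassX11a Wd p → ¬ Surj Wd p → (p = 5 ∨ p = 7) → p ∣ padicValInt p Wd.minimalDiscriminantInt →
        ¬ X11a.ShaAnUnit Wd p →
        ∀ {N : ℕ} [NeZero N] (f : CuspForm (Gamma0 N) 2), IsNewformOf Wd f →
        ∀ (ϖ : ℚ), (ϖ : ℝ) * Wd.realPeriodRat = plusPeriod f →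
        ∀ (a : ℚ_[p]) (L : PowerSeries ℚ_[p]),
          (Wd.HasSplitMultiplicativeReductionAtPrime p → a = 1) →
          (¬ Wd.HasSplitMultiplicativeReductionAtPrime p → a = -1) →
          IsMultPAdicLFunctionOf f p a L →
          ∃ n : ℕ, ‖PowerSeries.coeff n (PowerSeries.C ((ϖ : ℚ) : ℚ_[p]) * L)‖ = 1) ∧
      (∀ (W : WeierstrassCurve ℚ) [W.IsElliptic] [W.IsGloballyMinimal] (p : ℕ) [Fact p.Prime],
        ClassX11b W p → ¬ Surj W p → (p = 5 ∨ p = 7) → p ∣ padicValInt p W.minimalDiscriminantInt →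
        ¬ Ram W p → (∃ s : ℚ, shaAn W = (s : ℂ) ∧ 0 < padicValRat p s) →
        ∀ (K : Type) [Field K] [NumberField K] (Wd : WeierstrassCurve ℚ) [Wd.IsElliptic] [Wd.IsGloballyMinimal]
          (Cd : VariableChange ℚ),
          IsImaginaryQuadratic K → SatisfiesHeegnerHypothesis (W.conductorNorm ℤ) K →
          (W.quadraticTwist (NumberField.discr K : ℚ)).entireLFunction 1 ≠ 0 →
          Cd • W.quadraticTwist (NumberField.discr K : ℚ) = Wd →
          ClassX11a Wd p → ¬ Surj Wd p → p ∣ padicValInt p Wd.minimalDiscriminantInt →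
          ∀ {N : ℕ} [NeZero N] (f : CuspForm (Gamma0 N) 2), IsNewformOf Wd f →
          ∀ (ϖ : ℚ), (ϖ : ℝ) * Wd.realPeriodRat = plusPeriod f →
          ∀ (a : ℚ_[p]) (L : PowerSeries ℚ_[p]),
            (Wd.HasSplitMultiplicativeReductionAtPrime p → a = 1) →
            (¬ Wd.HasSplitMultiplicativeReductionAtPrime p → a = -1) →
            IsMultPAdicLFunctionOf f p a L →
            ∃ n : ℕ, ‖PowerSeries.coeff n (PowerSeries.C ((ϖ : ℚ) : ℚ_[p]) * L)‖ = 1))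
    -- slot 3 (r14): FIFTEEN named facts — r11–r13's sixteen minus conjunct 16 (Cha 2005 Rmk. 25 upper, discharged inside on the corner)
    (hF3 :
      (∀ (N : ℕ) [NeZero N] (W : WeierstrassCurve ℚ) (K : Type) [Field K] [NumberField K], Literature.NumberTheory.EllipticCurves.gross_zagier N W K) ∧
      (∀ (N : ℕ) [NeZero N] (W : WeierstrassCurve ℚ) (K : Type) [Field K] [NumberField K], Literature.NumberTheory.EllipticCurves.kolyvagin N W K) ∧
      Literature.NumberTheory.EllipticCurves.Wuthrich2014.sha_dvd_analyticSha ∧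
      Literature.NumberTheory.EllipticCurves.rank_eq_analyticRank_of_analyticRank_le_one ∧
      Literature.NumberTheory.EllipticCurves.ModularForms.exists_isNewformOf ∧
      Literature.NumberTheory.EllipticCurves.friedbergHoffstein_exists_heegnerField_split_twist_ne_zero ∧
      Literature.NumberTheory.EllipticCurves.ModularForms.mazur_not_dvd_maninConstant_of_odd ∧
      Literature.NumberTheory.EllipticCurves.SteinWuthrich2013.thm61_splitMultiplicative ∧
      Literature.NumberTheory.EllipticCurves.SteinWuthrich2013.thm61_nonsplitMultiplicative ∧
      (∀ (W : WeierstrassCurve ℚ) [W.IsElliptic] [W.IsGloballyMinimal] (p : ℕ) [Fact p.Prime], Literature.NumberTheory.EllipticCurves.greenberg_stevens (W := W) (p := p)) ∧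
      Literature.NumberTheory.EllipticCurves.Cha2005.rmk25_pow_dvd_card_sha_primary_of_certificate ∧
      Literature.NumberTheory.EllipticCurves.Kato2004.thm12_4 ∧
      Literature.NumberTheory.EllipticCurves.Kato2004.exists_multDivisibilityInputs_nonsplit_contra ∧
      Literature.NumberTheory.EllipticCurves.Kato2004.exists_multDivisibilityInputs_split_contra ∧
      Literature.NumberTheory.EllipticCurves.Kato2004.exists_multDivisibilityInputs_fine_contra)
    -- slot 4 (r7): the six Hida-side NAMED facts of x11a's non-surjective chain
    (hHida : EmertonPollackWeston2006.thm311_cotorsion_weightK_member_ofLevel ∧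
      EmertonPollackWeston2006.thm1_muAlg_of_weightK_member_ofLevel ∧
      Wan2015.thm4_rational_weightK_member_of_bdd_ofLevel_irred ∧
      EmertonPollackWeston2006.thm513_transfer_from_weightK_member_of_bdd_ofLevel ∧
      DeligneSerre1974.thm61_exists_adicGaloisRep ∧ Hida2000_thm326_ordinary)
    -- slot 5, conjunct 1 (r16): TWO names — Poitou–Tate for Selmer structures is a tree theorem (selmerComplement_canonical_holds)
    (hMax2 : GrossLMS1991.prop37_2_frobeniusCongruence ∧ Gross1991_heegnerPoint_sub_ratTorsion_mem_E0_imageFree)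
    -- slot 5, conjunct 2 (r17): FOUR Shimura names — the CM primitives come from slot 6's labelled family
    (hShim4 : friedbergHoffstein_exists_twist_ne_zero_inertAt ∧ nonempty_shimuraParametrizationData ∧
      PastenShimura2024_componentOrders ∧
      (∀ (K : Type) [Field K] [NumberField K], casselsTate_levelInputs K))
    -- slot 6 (r10): the labelled CM family at the corner's inert frames with `d_K < −4`, WITH (B6) ONLY AT THE CARRIER PRIMES outside `S`
    (hLabB6T : ∀ (W : WeierstrassCurve ℚ) [W.IsElliptic] [W.IsGloballyMinimal] (p : ℕ) [Fact p.Prime],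
      ClassX11b W p → ¬ Surj W p → (p = 5 ∨ p = 7) →
      ∀ (N : ℕ) [NeZero N] (K : Type) [Field K] [NumberField K] (S : Finset ℕ) (Dt : ModularParametrizationData W N)
        (X : ShimuraCurveData (∏ q ∈ S, q) (N / ∏ q ∈ S, q)) (W' : WeierstrassCurve ℚ) [W'.IsElliptic]
        (P₀ : ShimuraParametrizationData X W'),
        W.conductorNorm ℤ = N → IsImaginaryQuadratic K → NumberField.discr K < -4 → Even S.card →
        (∀ ℓ ∈ S, ℓ.Prime ∧ ℓ ∣ N ∧ ¬ ℓ ^ 2 ∣ N ∧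
          ((Ideal.span {(ℓ : ℤ)}).primesOver (𝓞 K)).ncard = 1 ∧ ¬ (ℓ : ℤ) ∣ NumberField.discr K) →
        (∀ ℓ : ℕ, ℓ.Prime → ℓ ∣ N → ℓ ∉ S → ((Ideal.span {(ℓ : ℤ)}).primesOver (𝓞 K)).ncard = 2) →
        p ∈ S → ¬ (p : ℤ) ∣ Dt.c → P₀.IsMinimalFor W →
        ∃ (ι : K →+* ℂ) (y : (W.baseChange K).toAffine.Point) (degy : ℕ)
          (ys : (m : ℕ) → (W.baseChange (ringClassField K ι m)).toAffine.Point) (ε : ℤ), 0 < degy ∧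
          padicValNat p degy = padicValNat p P₀.deg ∧
          LDerivEK W K = 8 * (Real.pi : ℂ) ^ 2 * peterssonProduct (CongruenceSubgroup.Gamma0 N) 2 Dt.f Dt.f /
              ((((Units.torsionOrder K : ℝ) / 2) ^ 2 * √|(NumberField.discr K : ℝ)| : ℝ) : ℂ) *
            ((y.canonicalHeight : ℂ) / (degy : ℂ)) ∧
          (¬ IsOfFinAddOrder y → 0 < (AddSubgroup.zmultiples y).index) ∧
          ShimuraWalk.LabelsAt W N K ι y ys ε ∧
          ∀ (q : ℕ) [Fact q.Prime], q ∣ N → q ∉ S → p ∣ (W.baseChange ℚ_[q]).localTamagawaNumber ℤ_[q] → LabelB6 ι W N {q} ys) :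
    Summit.BirchSwinnertonDyer.BirchSwinnertonDyer.Theses.ErratumRoadFive.NonSurjCorner := by
  obtain ⟨hGZ, hKo, hWu, hGZK, hnf, hFHs, hMaz, hJs, hJn, hGS, hChaL, h12, hns', hsp', hfine'⟩ := hF3
  obtain ⟨h311, hT1a, hT2, hT1b, h61, h326⟩ := hHida
  obtain ⟨h37, hF1⟩ := hMax2
  -- Poitou–Tate duality for the tree's Selmer structures: a THEOREM (Milne I 4.10(b) for the canonical maps, cell bsd-schneider p626891)
  have hPTs : ∀ (K : Type) [Field K] [NumberField K], poitouTate_selmerStructure_duality_conj K :=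
    poitouTate_conj_forall_of_selmerComplement_canonical
      (fun K _ _ n _ ↦ SchneiderFreeAdditiveX3.PoitouTateReduction.selmerComplement_canonical_holds K n)
  obtain ⟨hFH, hJL, hCO, hCT⟩ := hShim4
  -- the seven former slot-3 conjuncts that are THEOREMS of the tree
  have hmod : hasEntireLFunction_rat := hasEntireLFunction_rat_of_exists_isNewformOf hnf
  have hpar : nonempty_modularParametrizationData :=
    nonempty_modularParametrizationData_of_exists_isNewformOf hnf IsNewformOf.exists_maninConstant_ne_zero_holds
  have hrec : ∀ (N : ℕ) [NeZero N] (W : WeierstrassCurve ℚ) (K : Type) [Field K] [NumberField K],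
      heegnerPointOfConductor_one_galoisConj N W K :=
    fun N _ W K _ _ ↦ heegnerPointOfConductor_one_galoisConj_holds N W K
  have hD36 : ∀ (N : ℕ) [NeZero N] (W : WeierstrassCurve ℚ) (K : Type) [Field K] [NumberField K],
      phi_heegnerTau_mem_singularModuliField N W K :=
    fun N _ W K _ _ ↦ phi_heegnerTau_mem_singularModuliField_holds N W K
  have hPT : ∀ (K : Type) [Field K] [NumberField K],
      Literature.NumberTheory.GaloisCohomology.poitouTate_sum_localTatePairing_eq_zero K :=
    poitouTate_sum_localTatePairing_eq_zero_holds
  have hBR : localTamagawaNumber_quadraticTwist_two_mem_of_goodReduction :=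
    BarriosEtAl2025.localTamagawaNumber_quadraticTwist_two_mem_of_goodReduction_holds
  obtain ⟨hμT, hμD⟩ := hμ2
  -- slot 4: the leaf-twin lower half AT THE TWINS WITH NON-UNIT #Ш_an, from (2a) pointwise + the six Hida facts (x11a's `_of_mazur` door)
  have h₄ℓ : ∀ (Wd : WeierstrassCurve ℚ) [Wd.IsElliptic] [Wd.IsGloballyMinimal] (p : ℕ) [Fact p.Prime],
      ClassX11a Wd p → ¬ Surj Wd p → (p = 5 ∨ p = 7) → p ∣ padicValInt p Wd.minimalDiscriminantInt →
      ¬ X11a.ShaAnUnit Wd p → Typed.MissingLowerBoundAt Wd p :=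
    fun Wd _ _ p _ hXa hnsd h57 hvd hsu ↦
      hXa.missingLowerBoundAt_of_muAnZeroAt_of_not_surj_of_contraFacts_of_mazur hnf h311 hT1a hT2 hT1b h61 h326 h12 hns'
        hsp' hfine' hMaz hJs hJn hGZK (hGS Wd p) hnsd (by rcases h57 with rfl | rfl <;> omega)
        (NonSurjChain.muAnZeroAt_of_allowableRootShape Wd p (fun f hf ϖ hϖ a L h1 h2 hL ↦
          hμT Wd p hXa hnsd h57 hvd hsu f hf ϖ hϖ a L h1 h2 hL))
  exact X11b.erratumRoadFive_nonSurjCorner_of_kolyZShaAn_of_kolyJMax_of_multiUpper_of_lowerLeafTwinDeep_of_twinMultDivisibilityDeep_of_casselsTate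
    hGZ hKo hWu hGZK hmod hnf hpar hFHs hMaz hrec hD36 hJs hJn hGS hChaL hCT h37 h₄ℓ hZan
    (X11b.Three.Koly.nonSurjCornerKolyJ_max_of_threeNamedFacts h37 hPTs hF1)
    (fun W _ _ p _ hX hns' h57 hv hnr htam hmulti ↦
      -- EVERY multi-carrier pair: parity datum + datum-free roads (p-anchor), BOTH displays from slot 6; twin-lower from FH + leaf-twin lower half
      NonSurjCorner.missingUpperBoundAt_of_carrierLabelsB6_of_twinLower_pAnchor hGZK hmod hnf hMaz hBR hJL hCO hPT hPTs hCT hLabB6T W p hX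
        hns' h57 htam hmulti (NonSurjCorner.fhTwinLowerSupplyAt_of_lowerLeafTwinDeep hGZK hmod hnf hFH h₄ℓ W p hX hns' h57 hv hnr))
    (fun W _ _ p _ hX hnsW h57 hv hnr hspos K _ _ Wd _ _ Cd hK hHN hLt hWd hXa hnsd hvd ↦
      X11b.multDivisibilityAt_of_katoFacts_of_muAn_contra_of_mazur Kato2004.nonempty_iwasawaH1Data_holds h12 hnf hns' hsp' hfine'
        hMaz Wd p hXa.2.1 hXa.2.2.1 hXa.2.2.2.1 hnsd
        (fun f hf ϖ hϖ a L hsa hna hL ↦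
          hμD W p hX hnsW h57 hv hnr hspos K Wd Cd hK hHN hLt hWd hXa hnsd hvd f hf ϖ hϖ a L hsa hna hL))

/-! ### §2 r17's slot 2 implies the cut (projection) -/

/-- **Item 19948 implies `(2a) ∧ (2b)`** (both clauses are restrictions of 19948's `∀` with extra displayed hypotheses). So every registered slot of
r17 still closes the line through glue #20H, and registering the cut loses nothing. Nothing asserted about any curve.
[cite: GreenbergLNM1716, §1 Conj. 1.11 (p. 61)] -/
theorem twinMuAnDeepOr_of_twinMuAn
    (hμ : Summit.BirchSwinnertonDyer.BirchSwinnertonDyer.Theses.ErratumRoadFive.NonSurjCornerTwinMuAn) :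
    (∀ (Wd : WeierstrassCurve ℚ) [Wd.IsElliptic] [Wd.IsGloballyMinimal] (p : ℕ) [Fact p.Prime],
        ClassX11a Wd p → ¬ Surj Wd p → (p = 5 ∨ p = 7) → p ∣ padicValInt p Wd.minimalDiscriminantInt →
        ¬ X11a.ShaAnUnit Wd p →
        ∀ {N : ℕ} [NeZero N] (f : CuspForm (Gamma0 N) 2), IsNewformOf Wd f →
        ∀ (ϖ : ℚ), (ϖ : ℝ) * Wd.realPeriodRat = plusPeriod f →
        ∀ (a : ℚ_[p]) (L : PowerSeries ℚ_[p]),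
          (Wd.HasSplitMultiplicativeReductionAtPrime p → a = 1) →
          (¬ Wd.HasSplitMultiplicativeReductionAtPrime p → a = -1) →
          IsMultPAdicLFunctionOf f p a L →
          ∃ n : ℕ, ‖PowerSeries.coeff n (PowerSeries.C ((ϖ : ℚ) : ℚ_[p]) * L)‖ = 1) ∧
      (∀ (W : WeierstrassCurve ℚ) [W.IsElliptic] [W.IsGloballyMinimal] (p : ℕ) [Fact p.Prime],
        ClassX11b W p → ¬ Surj W p → (p = 5 ∨ p = 7) → p ∣ padicValInt p W.minimalDiscriminantInt →
        ¬ Ram W p → (∃ s : ℚ, shaAn W = (s : ℂ) ∧ 0 < padicValRat p s) →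
        ∀ (K : Type) [Field K] [NumberField K] (Wd : WeierstrassCurve ℚ) [Wd.IsElliptic] [Wd.IsGloballyMinimal]
          (Cd : VariableChange ℚ),
          IsImaginaryQuadratic K → SatisfiesHeegnerHypothesis (W.conductorNorm ℤ) K →
          (W.quadraticTwist (NumberField.discr K : ℚ)).entireLFunction 1 ≠ 0 →
          Cd • W.quadraticTwist (NumberField.discr K : ℚ) = Wd →
          ClassX11a Wd p → ¬ Surj Wd p → p ∣ padicValInt p Wd.minimalDiscriminantInt →
          ∀ {N : ℕ} [NeZero N] (f : CuspForm (Gamma0 N) 2), IsNewformOf Wd f →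
          ∀ (ϖ : ℚ), (ϖ : ℝ) * Wd.realPeriodRat = plusPeriod f →
          ∀ (a : ℚ_[p]) (L : PowerSeries ℚ_[p]),
            (Wd.HasSplitMultiplicativeReductionAtPrime p → a = 1) →
            (¬ Wd.HasSplitMultiplicativeReductionAtPrime p → a = -1) →
            IsMultPAdicLFunctionOf f p a L →
            ∃ n : ℕ, ‖PowerSeries.coeff n (PowerSeries.C ((ϖ : ℚ) : ℚ_[p]) * L)‖ = 1) := by
  refine ⟨?_, ?_⟩
  · intro Wd _ _ p _ hXa hnsd h57 hvd _ N _ f hf ϖ hϖ a L hsa hna hL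
    exact hμ Wd p hXa hnsd h57 hvd f hf ϖ hϖ a L hsa hna hL
  · intro W _ _ p _ _ _ h57 _ _ _ K _ _ Wd _ _ Cd _ _ _ _ hXa hnsd hvd N _ f hf ϖ hϖ a L hsa hna hL
    exact hμ Wd p hXa hnsd h57 hvd f hf ϖ hϖ a L hsa hna hL

end Summit.BirchSwinnertonDyer.BirchSwinnertonDyer.Theorems

end
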